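import Mathlib.Probability.Distributions.Gaussian.Real
import Mathlib.MeasureTheory.Measure.CharacteristicFunction.Basic
import Mathlib.Probability.Distributions.Gaussian.Basic
import Mathlib.Probability.Distributions.Gaussian.IsGaussianProcess.Basic
import Mathlib.Probability.Distributions.Gaussian.HasGaussianLaw.Basic
import Literature.MathematicalPhysics.QuantumFieldTheory.CurvatureGaussianField
import HarnessLib

/-!
# Stub `stub_gaussFromCharFun` of line `Sketch` (crux `stmt-QuantumFields-8760`)

Route `EquipartitionCriticality` of `YangMills`, crux item `stmt-QuantumFields-8760`
(`Summit.QuantumFields.YangMills.Theses.EquipartitionCriticality.EquipartitionPinsProbe`), line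
`Sketch`, STUB R6 of the lead's skeleton.

What is proved: a probability measure `τ` on `ℝ^D`-valued `2`-cochains
`Y : ZdPlaquette 4 → Fin D → ℝ` of `ℤ⁴` whose characteristic functional on finitely supported test
functions `h` is the Gaussian one,
`E cos ⟨Y, h⟩_S = exp (-Q_S(h) / 2)`, `E sin ⟨Y, h⟩_S = 0`, where
`⟨Y, h⟩_S = ∑_{p ∈ S} ∑_a h p a · Y p a` and
`Q_S(h) = ∑_{p, q ∈ S} ∑_a h p a · h q a · curvatureTwoPoint p q` (colours independent, same
two-plaquette kernel), IS the curvature Gaussian field `curvatureGaussianField 4 D`.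

Proof: for every `S`, `h` the law of the pairing `⟨Y, h⟩_S` under `τ` has characteristic function
`t ↦ exp (-Q_S(h) t² / 2)` (scale `h` by `t`), hence (`Measure.ext_of_charFun`,
`charFun_gaussianReal`) it is the centred real Gaussian of variance `Q_S(h)` (which is `≥ 0` because
`exp (-Q_S(h)/2) = E cos ≤ 1`). Every continuous linear functional of finitely many coordinates
`Y p a` is such a pairing, so the coordinate process `(p, a) ↦ Y p a` is a Gaussian process
(`isGaussian_of_map_eq_gaussianReal`); its means vanish and, by polarisation of
`Var ⟨Y, h⟩_S = Q_S(h)`, its covariances are `Cov(Y p a, Y q b) = [a = b] curvatureTwoPoint p q`.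
The tree's uniqueness theorem `eq_curvatureGaussianField_of_isGaussianProcess` concludes.
-/

noncomputable section

open MeasureTheory ProbabilityTheory Complex
open Literature.MathematicalPhysics.QuantumFieldTheory Literature.MathematicalPhysics.QuantumLattice

namespace Summit.QuantumFields.YangMills.Theorems.EquipartitionPinsProbe

namespace GaussFromCharFun

variable {D : ℕ}

/-- **Delta test functions evaluate.** For `p₀ ∈ S`, pairing against the indicator of `(p₀, a₀)`
picks out the `(p₀, a₀)` coordinate: `∑_{p ∈ S} ∑_a [p = p₀ ∧ a = a₀] g p a = g p₀ a₀`. -/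
theorem sum_sum_ite_mul (S : Finset (ZdPlaquette 4)) {p₀ : ZdPlaquette 4} (hp₀ : p₀ ∈ S)
    (a₀ : Fin D) (g : ZdPlaquette 4 → Fin D → ℝ) :
    ∑ p ∈ S, ∑ a : Fin D, (if p = p₀ ∧ a = a₀ then (1 : ℝ) else 0) * g p a = g p₀ a₀ := by
  have hinner : ∀ p : ZdPlaquette 4,
      ∑ a : Fin D, (if p = p₀ ∧ a = a₀ then (1 : ℝ) else 0) * g p a =
        if p = p₀ then g p a₀ else 0 := by
    intro p
    by_cases hp : p = p₀
    · simp [hp]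
    · simp [hp]
  simp_rw [hinner]
  rw [Finset.sum_ite_eq', if_pos hp₀]

/-- **The bilinear form of the kernel on two delta test functions** (`p₀, q₀ ∈ S`):
`∑_{p, q ∈ S} ∑_a [p = p₀ ∧ a = a₀] [q = q₀ ∧ a = b₀] T(p, q) = [a₀ = b₀] T(p₀, q₀)`. -/
theorem sum_sum_sum_ite_ite (S : Finset (ZdPlaquette 4)) {p₀ q₀ : ZdPlaquette 4} (hp₀ : p₀ ∈ S)
    (hq₀ : q₀ ∈ S) (a₀ b₀ : Fin D) :
    ∑ p ∈ S, ∑ q ∈ S, ∑ a : Fin D, (if p = p₀ ∧ a = a₀ then (1 : ℝ) else 0) *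
        (if q = q₀ ∧ a = b₀ then (1 : ℝ) else 0) * curvatureTwoPoint p q =
      if a₀ = b₀ then curvatureTwoPoint p₀ q₀ else 0 := by
  calc ∑ p ∈ S, ∑ q ∈ S, ∑ a : Fin D, (if p = p₀ ∧ a = a₀ then (1 : ℝ) else 0) *
        (if q = q₀ ∧ a = b₀ then (1 : ℝ) else 0) * curvatureTwoPoint p q
      = ∑ p ∈ S, ∑ a : Fin D, (if p = p₀ ∧ a = a₀ then (1 : ℝ) else 0) *
          ∑ q ∈ S, (if q = q₀ ∧ a = b₀ then (1 : ℝ) else 0) * curvatureTwoPoint p q := by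
        refine Finset.sum_congr rfl fun p _ => ?_
        rw [Finset.sum_comm]
        simp_rw [Finset.mul_sum, mul_assoc]
    _ = ∑ q ∈ S, (if q = q₀ ∧ a₀ = b₀ then (1 : ℝ) else 0) * curvatureTwoPoint p₀ q :=
        sum_sum_ite_mul S hp₀ a₀ fun p a =>
          ∑ q ∈ S, (if q = q₀ ∧ a = b₀ then (1 : ℝ) else 0) * curvatureTwoPoint p q
    _ = if a₀ = b₀ then curvatureTwoPoint p₀ q₀ else 0 := by
        by_cases hab : a₀ = b₀
        · simp [hab, hq₀]
        · simp [hab]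

/-- **Finite linear combinations of coordinates are pairings**: for coefficients `c k` and
(plaquette, colour) indices `e k`,
`∑_k c k · ω (e k) = ⟨ω, h⟩_S` with `S` the set of plaquettes of the `e k` and
`h p a = ∑_k c k [p = (e k).1 ∧ a = (e k).2]`. -/
theorem sum_mul_eval_eq_pairing {κ : Type*} [Fintype κ] (c : κ → ℝ) (e : κ → ZdPlaquette 4 × Fin D)
    (ω : ZdPlaquette 4 → Fin D → ℝ) :
    ∑ k, c k * ω (e k).1 (e k).2 =
      ∑ p ∈ Finset.univ.image (fun k => (e k).1), ∑ a : Fin D,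
        (∑ k, c k * (if p = (e k).1 ∧ a = (e k).2 then (1 : ℝ) else 0)) * ω p a := by
  symm
  calc ∑ p ∈ Finset.univ.image (fun k => (e k).1), ∑ a : Fin D,
        (∑ k, c k * (if p = (e k).1 ∧ a = (e k).2 then (1 : ℝ) else 0)) * ω p a
      = ∑ p ∈ Finset.univ.image (fun k => (e k).1), ∑ a : Fin D,
          ∑ k, c k * ((if p = (e k).1 ∧ a = (e k).2 then (1 : ℝ) else 0) * ω p a) := by
        simp_rw [Finset.sum_mul, mul_assoc]
    _ = ∑ p ∈ Finset.univ.image (fun k => (e k).1), ∑ k, ∑ a : Fin D,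
          c k * ((if p = (e k).1 ∧ a = (e k).2 then (1 : ℝ) else 0) * ω p a) :=
        Finset.sum_congr rfl fun _ _ => Finset.sum_comm
    _ = ∑ k, ∑ p ∈ Finset.univ.image (fun k => (e k).1), ∑ a : Fin D,
          c k * ((if p = (e k).1 ∧ a = (e k).2 then (1 : ℝ) else 0) * ω p a) :=
        Finset.sum_comm
    _ = ∑ k, c k * ω (e k).1 (e k).2 := by
        refine Finset.sum_congr rfl fun k _ => ?_
        have hk : (e k).1 ∈ Finset.univ.image (fun k => (e k).1) :=
          Finset.mem_image.2 ⟨k, Finset.mem_univ k, rfl⟩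
        simp_rw [← Finset.mul_sum]
        rw [sum_sum_ite_mul _ hk (e k).2 ω]

/-- The pairing `Y ↦ ⟨Y, h⟩_S = ∑_{p ∈ S} ∑_a h p a · Y p a` is measurable. -/
theorem measurable_pairing (S : Finset (ZdPlaquette 4)) (h : ZdPlaquette 4 → Fin D → ℝ) :
    Measurable fun Y : ZdPlaquette 4 → Fin D → ℝ => ∑ p ∈ S, ∑ a : Fin D, h p a * Y p a := by
  refine Finset.measurable_sum _ fun p _ => Finset.measurable_sum _ fun a _ => ?_
  have hpa : Measurable fun Y : ZdPlaquette 4 → Fin D → ℝ => Y p a :=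
    (measurable_pi_apply a).comp (measurable_pi_apply p)
  exact hpa.const_mul _

/-- **The characteristic function of the law of a pairing** in terms of the trigonometric
moments: `charFun (τ ∘ ⟨·, h⟩_S⁻¹) t = E cos ⟨Y, t h⟩_S + i E sin ⟨Y, t h⟩_S`. -/
theorem charFun_map_pairing (τ : Measure (ZdPlaquette 4 → Fin D → ℝ)) [IsProbabilityMeasure τ]
    (S : Finset (ZdPlaquette 4)) (h : ZdPlaquette 4 → Fin D → ℝ) (t : ℝ) :
    charFun (τ.map fun Y : ZdPlaquette 4 → Fin D → ℝ => ∑ p ∈ S, ∑ a : Fin D, h p a * Y p a) t =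
      ((∫ Y, Real.cos (∑ p ∈ S, ∑ a : Fin D, t * h p a * Y p a) ∂τ : ℝ) : ℂ) +
        ((∫ Y, Real.sin (∑ p ∈ S, ∑ a : Fin D, t * h p a * Y p a) ∂τ : ℝ) : ℂ) * I := by
  rw [charFun_apply_real, integral_map (measurable_pairing S h).aemeasurable (by fun_prop)]
  have hscale : ∀ Y : ZdPlaquette 4 → Fin D → ℝ,
      t * ∑ p ∈ S, ∑ a : Fin D, h p a * Y p a = ∑ p ∈ S, ∑ a : Fin D, t * h p a * Y p a := by
    intro Y
    simp_rw [Finset.mul_sum, mul_assoc]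
  have hfun : (fun Y : ZdPlaquette 4 → Fin D → ℝ =>
      cexp (↑t * ↑(∑ p ∈ S, ∑ a : Fin D, h p a * Y p a) * I)) =
      fun Y => cexp (↑(∑ p ∈ S, ∑ a : Fin D, t * h p a * Y p a) * I) := by
    funext Y
    rw [← hscale, Complex.ofReal_mul]
  have hint : Integrable (fun Y : ZdPlaquette 4 → Fin D → ℝ =>
      cexp (↑(∑ p ∈ S, ∑ a : Fin D, t * h p a * Y p a) * I)) τ := by
    refine Integrable.of_bound ?_ 1 (ae_of_all _ fun Y => (norm_exp_ofReal_mul_I _).le)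
    exact (Complex.continuous_exp.measurable.comp
      ((Complex.measurable_ofReal.comp (measurable_pairing S _)).mul_const I)).aestronglyMeasurable
  rw [hfun]
  have key := integral_re_add_im hint
  simp only [RCLike.re_to_complex, RCLike.im_to_complex, RCLike.I_to_complex,
    exp_ofReal_mul_I_re, exp_ofReal_mul_I_im] at key
  exact key.symm

section Hyp

variable {τ : Measure (ZdPlaquette 4 → Fin D → ℝ)} [IsProbabilityMeasure τ]
  (hΦ : ∀ (S : Finset (ZdPlaquette 4)) (h : ZdPlaquette 4 → Fin D → ℝ),
    (∫ Y, Real.cos (∑ p ∈ S, ∑ a : Fin D, h p a * Y p a) ∂τ =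
      Real.exp (-(∑ p ∈ S, ∑ q ∈ S, ∑ a : Fin D,
        h p a * h q a * curvatureTwoPoint p q) / 2)) ∧
    (∫ Y, Real.sin (∑ p ∈ S, ∑ a : Fin D, h p a * Y p a) ∂τ = 0))
include hΦ

/-- **The quadratic form `Q_S(h)` is nonnegative**, because `exp (-Q_S(h)/2) = E cos ⟨Y, h⟩_S ≤ 1`. -/
theorem quadForm_nonneg (S : Finset (ZdPlaquette 4)) (h : ZdPlaquette 4 → Fin D → ℝ) :
    0 ≤ ∑ p ∈ S, ∑ q ∈ S, ∑ a : Fin D, h p a * h q a * curvatureTwoPoint p q := by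
  have h1 := (hΦ S h).1
  have hle : ∫ Y, Real.cos (∑ p ∈ S, ∑ a : Fin D, h p a * Y p a) ∂τ ≤ 1 := by
    have hb := norm_integral_le_of_norm_le_const (μ := τ)
      (f := fun Y : ZdPlaquette 4 → Fin D → ℝ => Real.cos (∑ p ∈ S, ∑ a : Fin D, h p a * Y p a))
      (C := 1) (ae_of_all _ fun Y => by
        rw [Real.norm_eq_abs]
        exact Real.abs_cos_le_one _)
    rw [probReal_univ, mul_one, Real.norm_eq_abs] at hb
    exact (le_abs_self _).trans hb
  rw [h1, Real.exp_le_one_iff] at hle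
  linarith

/-- **The law of every pairing is a centred real Gaussian**:
`τ ∘ ⟨·, h⟩_S⁻¹ = gaussianReal 0 (Q_S(h))` (characteristic functions agree, `Measure.ext_of_charFun`). -/
theorem map_pairing_eq_gaussianReal (S : Finset (ZdPlaquette 4)) (h : ZdPlaquette 4 → Fin D → ℝ) :
    τ.map (fun Y : ZdPlaquette 4 → Fin D → ℝ => ∑ p ∈ S, ∑ a : Fin D, h p a * Y p a) =
      gaussianReal 0 (∑ p ∈ S, ∑ q ∈ S, ∑ a : Fin D,
        h p a * h q a * curvatureTwoPoint p q).toNNReal := by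
  refine Measure.ext_of_charFun (funext fun t => ?_)
  rw [charFun_map_pairing, charFun_gaussianReal]
  obtain ⟨hc, hs⟩ := hΦ S (fun p a => t * h p a)
  have hQ : ∑ p ∈ S, ∑ q ∈ S, ∑ a : Fin D, t * h p a * (t * h q a) * curvatureTwoPoint p q =
      t ^ 2 * ∑ p ∈ S, ∑ q ∈ S, ∑ a : Fin D, h p a * h q a * curvatureTwoPoint p q := by
    simp_rw [Finset.mul_sum]
    refine Finset.sum_congr rfl fun p _ => Finset.sum_congr rfl fun q _ =>
      Finset.sum_congr rfl fun a _ => ?_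
    ring
  rw [hc, hs, hQ, Real.coe_toNNReal _ (quadForm_nonneg hΦ S h), Complex.ofReal_exp]
  simp only [Complex.ofReal_zero, zero_mul, add_zero, mul_zero, zero_sub]
  congr 1
  push_cast
  ring

/-- Every pairing has a Gaussian law under `τ`. -/
theorem hasGaussianLaw_pairing (S : Finset (ZdPlaquette 4)) (h : ZdPlaquette 4 → Fin D → ℝ) :
    HasGaussianLaw (fun Y : ZdPlaquette 4 → Fin D → ℝ => ∑ p ∈ S, ∑ a : Fin D, h p a * Y p a) τ :=
  ⟨by rw [map_pairing_eq_gaussianReal hΦ S h]; infer_instance⟩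

/-- Every pairing is square integrable under `τ`. -/
theorem memLp_pairing (S : Finset (ZdPlaquette 4)) (h : ZdPlaquette 4 → Fin D → ℝ) :
    MemLp (fun Y : ZdPlaquette 4 → Fin D → ℝ => ∑ p ∈ S, ∑ a : Fin D, h p a * Y p a) 2 τ :=
  (hasGaussianLaw_pairing hΦ S h).memLp_two

/-- **Mean and variance of a pairing**: `E ⟨Y, h⟩_S = 0` and `Var ⟨Y, h⟩_S = Q_S(h)`. -/
theorem integral_pairing_and_variance (S : Finset (ZdPlaquette 4)) (h : ZdPlaquette 4 → Fin D → ℝ) :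
    ∫ Y, ∑ p ∈ S, ∑ a : Fin D, h p a * Y p a ∂τ = 0 ∧
    Var[fun Y : ZdPlaquette 4 → Fin D → ℝ => ∑ p ∈ S, ∑ a : Fin D, h p a * Y p a; τ] =
      ∑ p ∈ S, ∑ q ∈ S, ∑ a : Fin D, h p a * h q a * curvatureTwoPoint p q := by
  have h1 := (hasGaussianLaw_pairing hΦ S h).map_eq_gaussianReal
  rw [map_pairing_eq_gaussianReal hΦ S h, gaussianReal_ext_iff] at h1
  refine ⟨h1.1.symm, ?_⟩
  have h2 := h1.2
  rwa [Real.toNNReal_eq_toNNReal_iff (quadForm_nonneg hΦ S h) (variance_nonneg _ _),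
    eq_comm] at h2

/-- **Covariance of two pairings by polarisation**:
`Cov(⟨Y, h₁⟩_S, ⟨Y, h₂⟩_S) = ∑_{p, q ∈ S} ∑_a h₁ p a · h₂ q a · T(p, q)`. -/
theorem covariance_pairing (S : Finset (ZdPlaquette 4)) (h₁ h₂ : ZdPlaquette 4 → Fin D → ℝ) :
    cov[fun Y : ZdPlaquette 4 → Fin D → ℝ => ∑ p ∈ S, ∑ a : Fin D, h₁ p a * Y p a,
      fun Y : ZdPlaquette 4 → Fin D → ℝ => ∑ p ∈ S, ∑ a : Fin D, h₂ p a * Y p a; τ] =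
      ∑ p ∈ S, ∑ q ∈ S, ∑ a : Fin D, h₁ p a * h₂ q a * curvatureTwoPoint p q := by
  have hadd := variance_add (memLp_pairing hΦ S h₁) (memLp_pairing hΦ S h₂)
  have hsum : ((fun Y : ZdPlaquette 4 → Fin D → ℝ => ∑ p ∈ S, ∑ a : Fin D, h₁ p a * Y p a) +
      fun Y : ZdPlaquette 4 → Fin D → ℝ => ∑ p ∈ S, ∑ a : Fin D, h₂ p a * Y p a) =
      fun Y => ∑ p ∈ S, ∑ a : Fin D, (h₁ p a + h₂ p a) * Y p a := by
    funext Y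
    simp only [Pi.add_apply, add_mul, Finset.sum_add_distrib]
  rw [hsum, (integral_pairing_and_variance hΦ S fun p a => h₁ p a + h₂ p a).2,
    (integral_pairing_and_variance hΦ S h₁).2, (integral_pairing_and_variance hΦ S h₂).2] at hadd
  have hsymm : ∑ p ∈ S, ∑ q ∈ S, ∑ a : Fin D, h₂ p a * h₁ q a * curvatureTwoPoint p q =
      ∑ p ∈ S, ∑ q ∈ S, ∑ a : Fin D, h₁ p a * h₂ q a * curvatureTwoPoint p q := by
    rw [Finset.sum_comm]
    refine Finset.sum_congr rfl fun p _ => Finset.sum_congr rfl fun q _ =>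
      Finset.sum_congr rfl fun a _ => ?_
    rw [curvatureTwoPoint_comm]
    ring
  have hexp : ∑ p ∈ S, ∑ q ∈ S, ∑ a : Fin D,
      (h₁ p a + h₂ p a) * (h₁ q a + h₂ q a) * curvatureTwoPoint p q =
      ∑ p ∈ S, ∑ q ∈ S, ∑ a : Fin D, h₁ p a * h₁ q a * curvatureTwoPoint p q +
      ∑ p ∈ S, ∑ q ∈ S, ∑ a : Fin D, h₂ p a * h₂ q a * curvatureTwoPoint p q +
      2 * ∑ p ∈ S, ∑ q ∈ S, ∑ a : Fin D, h₁ p a * h₂ q a * curvatureTwoPoint p q := by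
    have hterm : ∀ (p q : ZdPlaquette 4) (a : Fin D),
        (h₁ p a + h₂ p a) * (h₁ q a + h₂ q a) * curvatureTwoPoint p q =
        h₁ p a * h₁ q a * curvatureTwoPoint p q + h₂ p a * h₂ q a * curvatureTwoPoint p q +
          h₁ p a * h₂ q a * curvatureTwoPoint p q + h₂ p a * h₁ q a * curvatureTwoPoint p q := by
      intro p q a
      ring
    simp_rw [hterm, Finset.sum_add_distrib]
    rw [hsymm]
    ring
  linarith

end Hyp

end GaussFromCharFun

open GaussFromCharFun in
/-- STUB R6 — **identification of the curvature Gaussian field from its characteristic functional**: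
a probability measure on `ℝ^D`-valued 2-cochains of `ℤ⁴` with `E cos⟨Y,h⟩ = exp(−½ ∑ h h T)` and
`E sin⟨Y,h⟩ = 0` for all finitely supported `h` (`T = curvatureTwoPoint`, colours independent) IS
`curvatureGaussianField 4 D` (every finite linear combination is `gaussianReal 0 (∑ h h T)` by
`Measure.ext_of_charFun`, hence the coordinate process is Gaussian with mean `0` and covariance
`δ_ab T`; conclude with `eq_curvatureGaussianField_of_isGaussianProcess`). -/
theorem stub_gaussFromCharFun :
    ∀ (D : ℕ) (τ : MeasureTheory.Measure
        (Literature.MathematicalPhysics.QuantumLattice.ZdPlaquette 4 → Fin D → ℝ)),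
      MeasureTheory.IsProbabilityMeasure τ →
      (∀ (S : Finset (Literature.MathematicalPhysics.QuantumLattice.ZdPlaquette 4))
          (h : Literature.MathematicalPhysics.QuantumLattice.ZdPlaquette 4 → Fin D → ℝ),
        (∫ Y, Real.cos (∑ p ∈ S, ∑ a : Fin D, h p a * Y p a) ∂τ =
          Real.exp (-(∑ p ∈ S, ∑ q ∈ S, ∑ a : Fin D,
            h p a * h q a * Literature.MathematicalPhysics.QuantumFieldTheory.curvatureTwoPoint p q) / 2)) ∧
        (∫ Y, Real.sin (∑ p ∈ S, ∑ a : Fin D, h p a * Y p a) ∂τ = 0)) →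
      τ = Literature.MathematicalPhysics.QuantumFieldTheory.curvatureGaussianField 4 D := by
  intro D τ hτ hΦ
  -- (1) the coordinate process is Gaussian: every linear functional of finitely many
  -- coordinates is a pairing, whose law is a real Gaussian
  have hG : IsGaussianProcess
      (fun (s : ZdPlaquette 4 × Fin D) (ω : ZdPlaquette 4 → Fin D → ℝ) => ω s.1 s.2) τ := by
    refine ⟨fun I => ⟨isGaussian_of_map_eq_gaussianReal fun L => ?_⟩⟩
    have hmeas : Measurable fun ω : ZdPlaquette 4 → Fin D → ℝ =>
        I.restrict fun s : ZdPlaquette 4 × Fin D => ω s.1 s.2 :=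
      measurable_pi_lambda _ fun s => (measurable_pi_apply _).comp (measurable_pi_apply _)
    have hL : (⇑L ∘ fun ω : ZdPlaquette 4 → Fin D → ℝ =>
          I.restrict fun s : ZdPlaquette 4 × Fin D => ω s.1 s.2) =
        fun ω => ∑ p ∈ Finset.univ.image (fun k : ↥I => (k : ZdPlaquette 4 × Fin D).1),
          ∑ a : Fin D, (∑ k : ↥I, L (fun j => if k = j then 1 else 0) *
            (if p = (k : ZdPlaquette 4 × Fin D).1 ∧ a = (k : ZdPlaquette 4 × Fin D).2
              then (1 : ℝ) else 0)) * ω p a := by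
      funext ω
      rw [Function.comp_apply]
      refine Eq.trans ?_ (sum_mul_eval_eq_pairing (fun k : ↥I => L (fun j => if k = j then 1 else 0))
        (fun k : ↥I => (k : ZdPlaquette 4 × Fin D)) ω)
      have key := LinearMap.pi_apply_eq_sum_univ (L : (↥I → ℝ) →ₗ[ℝ] ℝ)
        (I.restrict fun s : ZdPlaquette 4 × Fin D => ω s.1 s.2)
      simp only [ContinuousLinearMap.coe_coe] at key
      rw [key]
      refine Finset.sum_congr rfl fun k _ => ?_
      rw [smul_eq_mul]
      exact mul_comm _ _
    rw [Measure.map_map L.continuous.measurable hmeas, hL]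
    exact ⟨0, _, map_pairing_eq_gaussianReal hΦ _ _⟩
  -- (2) the means vanish
  have hm : ∀ (p : ZdPlaquette 4) (a : Fin D), ∫ ω, ω p a ∂τ = 0 := by
    intro p a
    have h := (integral_pairing_and_variance hΦ {p} fun p' a' => if p' = p ∧ a' = a then 1 else 0).1
    have e1 : (fun Y : ZdPlaquette 4 → Fin D → ℝ => ∑ p' ∈ ({p} : Finset (ZdPlaquette 4)),
        ∑ a' : Fin D, (if p' = p ∧ a' = a then (1 : ℝ) else 0) * Y p' a') = fun Y => Y p a :=
      funext fun Y => sum_sum_ite_mul _ (Finset.mem_singleton_self p) a Y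
    rw [e1] at h
    exact h
  -- (3) the covariances are `[a = b] T(p, q)` by polarisation
  have hc : ∀ (p q : ZdPlaquette 4) (a b : Fin D),
      cov[fun ω => ω p a, fun ω => ω q b; τ] = if a = b then curvatureTwoPoint p q else 0 := by
    intro p q a b
    have hp : p ∈ ({p, q} : Finset (ZdPlaquette 4)) := Finset.mem_insert_self p {q}
    have hq : q ∈ ({p, q} : Finset (ZdPlaquette 4)) :=
      Finset.mem_insert_of_mem (Finset.mem_singleton_self q)
    have h := covariance_pairing hΦ {p, q} (fun p' a' => if p' = p ∧ a' = a then 1 else 0)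
      (fun p' a' => if p' = q ∧ a' = b then 1 else 0)
    have e1 : (fun Y : ZdPlaquette 4 → Fin D → ℝ => ∑ p' ∈ ({p, q} : Finset (ZdPlaquette 4)),
        ∑ a' : Fin D, (if p' = p ∧ a' = a then (1 : ℝ) else 0) * Y p' a') = fun Y => Y p a :=
      funext fun Y => sum_sum_ite_mul _ hp a Y
    have e2 : (fun Y : ZdPlaquette 4 → Fin D → ℝ => ∑ p' ∈ ({p, q} : Finset (ZdPlaquette 4)),
        ∑ a' : Fin D, (if p' = q ∧ a' = b then (1 : ℝ) else 0) * Y p' a') = fun Y => Y q b :=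
      funext fun Y => sum_sum_ite_mul _ hq b Y
    rw [e1, e2, sum_sum_sum_ite_ite _ hp hq a b] at h
    exact h
  exact eq_curvatureGaussianField_of_isGaussianProcess (by norm_num) D hG hm hc

end Summit.QuantumFields.YangMills.Theorems.EquipartitionPinsProbe

end
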